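import Summits.QuantumFields.BalabanUV.Beta.D1BFx.RoadEndBFxTotalShellS
import Summits.QuantumFields.BalabanUV.Beta.D1BFx.RestTotalOfGroupsS
import Summits.QuantumFields.BalabanUV.Beta.D1BFx.RoadEndBFxTotalShellGroups

/-!
# `BalabanUV.Beta.D1BFx.RoadEndBFxTotalShellGroupsS` — road «BF-x» for binder row D1, THE DEBT END WITH ITS REST HYPOTHESIS RESHAPED INTO ONE BOUND
# PER IDENTITY-CLOSED GROUP, variant «ENDₛ» (END-ii-SPEC v1.1 §3 (b), chain link 5): gan24-leaf-05-g40's `RoadEndBFxTotalShellGroups` with the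
# loop-weight tie RESCALED by a displayed family `s : ℕ → ℝ` and the rest words `restKS n a (gfrz n a b) (s n • gfrz n a b)`

HONEST DEPENDENCY (page 1, mandatory): continuum YM on T⁴ ⇐ BetaPertH ∧ nine spine estimates (0/9 proved); BetaPertH ⇐ (D1) ∧ (D4) ∧
CAP+tail; G-an2-4 gates asym, D1 and NE2/3/4.  HONEST FRAMING (cell contract, verbatim): «discharging `BetaPertH` makes Bałaban's UV
stability UNCONDITIONAL — a real constructive-QFT result; it is NOT the continuum limit and NOT the Clay problem.»  THIS MODULE DISCHARGES
NOTHING of the wall: [folklore] ONE composition BY NAME of `RoadEndBFxTotalShellS.d1Drift_BFx_total_shell_of_prop12S` with the glue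
`RestTotalOfGroupsS.hRestTot_of_hGroupsS` (its (α)-leaf input from `GluonLegTails.hGa_of_prop12`).  No `def`, nothing cited, 0 sorry.  DISPLAYED DEBT AFTER THIS
FILE, BY NAME: bridge B1 (`hB1`); (K) `hK` + `hωs` + `hlam`; the five slot-table sockets; `hdiv`; `hrowgh`; the SHELL rows `h2s`∕`d2s`; the partition datum
`hcorner` and ONE n-uniform bound `hGrp g` per group `g ≠ g₀` of the two-profile words; (U); the two PRINTED statements `h12`∕`h126`.  0 wall binders
(hW ∕ hR-sockets ∕ hSX-socket ∕ D1Tel ∕ D1Rep = 0); NOT (K), NOT D1, NOT `BetaPertH`, NOT continuum, NOT Clay.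

ABSOLUTE RULE (cell charter, verbatim): «No internally-minted statement may enter as a cited fact. Every hypothesis is either kernel-proved in
this package or a verbatim quotation of a PUBLISHED theorem with page reference. The manuscript(s) under audit are NOT citable for their own
disputed steps — they are the thing under adjudication; programme-internal (2001/route/tribunal) claims are never citable.»

WHY (owner ruling ρ-g11-9; `END-ii-SPEC.md` v1.1; binder GO R-D1-g31-2 (b)).  This is the last MECHANICAL link below the group rows: the next files
(`RoadEndGroupsS`, `RoadEndBFxWiredS`) supply `hGrp` at the label of record `RoadEndBFxRows.grpRec` from the gluon group rows of record (T₁–T₃, L-TAD-E∕R, L-BUB,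
T₈, (Λ): their words are `restK'`'s at `gfrz`, rfl) and the NEW ghost rows under reading (ii) (T₄–T₇-ii at tolerance `n¹⁰`∕`n⁸`, L-GBUB-ii) once `s n = n⁻²` is
pinned — NOT mechanical, typed when those rows land.

CONTENT.
* [folklore] **`d1Drift_BFx_total_shell_of_prop12_of_groupsS`**.
Unit `b2b-balaban-beta-d1-p2` (road owner, gen 12); `LEAVES-BFx.md` row A7-ENDₛ (chain link 5, «TOTAL-SHELL-GROUPS-S»); END-ii-SPEC v1.1 §3 (b).
-/

noncomputable section

open Finset Filter Topology
open Literature.Probability.LatticeModels (annulus)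
open scoped BigOperators
open Literature.MathematicalPhysics.QuantumFieldTheory.Balaban1983to89
open Literature.MathematicalPhysics.QuantumFieldTheory.Balaban1983to89.Beta
open OneStepResolventKernel (JetData)
open OneStepKernelFamily (TbalOf D1Drift)
open WindowIdentification (fullSum psum)
open DyadicShell (Pt toReal supNorm)
open ExpKernelCalculus (Site MKer BiLoc shiftK)
open GhostTable (gFree)
open BubbleTransfer (unitVec)
open DressedMomentNormalisation (resSite)
open Summit.QuantumFields.BalabanUV.Beta.D1BFx.ReducedKernel (TableR TOfRed)
open Summit.QuantumFields.BalabanUV.Beta.D1BFx.DressedTadpoleTable (tableRed)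
open Summit.QuantumFields.BalabanUV.Beta.D1BFx.ReducedKernelSandwich (fineHess)
open Summit.QuantumFields.BalabanUV.Beta.D1BFx.FineStencilBFBalaban (SbfBal)
open Summit.QuantumFields.BalabanUV.Beta.D1BFx.SecondStencilBF (Wbf)
open Summit.QuantumFields.BalabanUV.Beta.D1BFx.GhostKernelComplete (PghQ fineHessGhQ)
open Summit.QuantumFields.BalabanUV.Beta.D1BFx.FrozenLegProfile (gfrz)
open Summit.QuantumFields.BalabanUV.Beta.D1BFx.SplitInstance (RestIdx)
open Summit.QuantumFields.BalabanUV.Beta.D1BFx.SplitInstanceS (restKS)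
open Summit.QuantumFields.BalabanUV.Beta.D1BFx.RoadEndBFxRecut (cornerIdx)
open Summit.QuantumFields.BalabanUV.Beta.D1BFx.RoadEndBFxTotalShellS (d1Drift_BFx_total_shell_of_prop12S)
open Summit.QuantumFields.BalabanUV.Beta.D1BFx.RestTotalOfGroupsS (hRestTot_of_hGroupsS)
open Summit.QuantumFields.BalabanUV.Beta.D1BFx.FrozenLegTails (nOf MOf hn1)
open Summit.QuantumFields.BalabanUV.Beta.D1BFx.GluonLegTails (hGa_of_prop12)
open VectorTailsLoc (fam kfam)

namespace Summit.QuantumFields.BalabanUV.Beta.D1BFx.RoadEndBFxTotalShellGroupsS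

variable {Lc : ℕ} [NeZero Lc] {a N : ℝ} {μ ν : Fin 4} {υ : Type*} [Fintype υ]
  {cE cVH cΛ cR cK cQ cE₂ cJ4 cΛ₂ cR₂ cQ₂ x₀ ωgl ωgh : ℕ → ℝ} {WE WJ WΛ WR WQ : ℕ → TableR} {CE CJ CΛ CRt CQ δW : ℕ → ℝ}
  {Ru : υ → ℕ → ℝ} {CU : υ → ℝ} {D₂ U₁ : ℝ} {G : Type*} [Fintype G] [DecidableEq G] {grp : RestIdx → G} {g₀ : G} {CG : G → ℝ}

/-- [folklore] **ROAD BF-x, THE «ENDₛ» DEBT END FED BY GROUP REST BOUNDS** (rescaled tie `hωs`, two-profile rest words `restKS (gfrz n a b) (s n • gfrz n a b)`;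
`s ≡ 1` = the END of record `RoadEndBFxTotalShellGroups.d1Drift_BFx_total_shell_of_prop12_of_groups`, `s n = n⁻²` = END-ii):
`RoadEndBFxTotalShellS.d1Drift_BFx_total_shell_of_prop12S` with `hRestTot` supplied by `RestTotalOfGroupsS.hRestTot_of_hGroupsS` from ONE n-uniform bound `CG g` per group `g ≠ g₀` of a label `grp : RestIdx → G` of the rest words whose fibre `g₀`
is exactly the corner (`hcorner`), `CRtot := Σ_{g ≠ g₀} CG g`; the glue's (α)-leaf input is `GluonLegTails.hGa_of_prop12`.  Displayed: B1, (K), sockets,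
`hdiv`, `hrowgh`, shell rows h2s∕d2s, the partition datum `hcorner`, ONE bound per group `hGrp` (two-profile words), (U), `h12`∕`h126`. -/
theorem d1Drift_BFx_total_shell_of_prop12_of_groupsS (Js : ℕ → JetData 3 Lc) (hμν : μ ≠ ν) (hN : N ≠ 0) (hL : 2 ≤ Lc) (hodd : Odd Lc)
    (ha : 0 < a) (c : ℕ → ℝ) {A₂ δ₂ : ℝ} (hD₂ : 0 ≤ D₂) (hA₂ : 0 ≤ A₂) (hδ₂ : 0 < δ₂)
    -- the two PRINTED statements, by name, for the family scale × even cubic volumes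
    (h12 : B5.Prop12Printed (fam nOf hn1 MOf a ha)) (h126 : B5.Kernel126_127Printed (kfam nOf MOf))
    -- the frozen profile's same-leg second differences, SHELL currency
    (h2s : ∀ n : ℕ, 2 ≤ n → ∀ [NeZero n], ∀ b ∈ (univ : Finset (Fin 4 → Fin n)).image resSite, ∀ r : ℕ, r + 1 ≤ n →
      ∑ v ∈ annulus 4 r (r + 1), |(gfrz n a b (v + unitVec ν + unitVec μ) - gFree (v + unitVec ν + unitVec μ)) -
          (gfrz n a b (v + unitVec ν) - gFree (v + unitVec ν)) - (gfrz n a b (v + unitVec μ) - gFree (v + unitVec μ)) +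
          (gfrz n a b v - gFree v)| ≤ D₂ / (n : ℝ))
    (d2s : ∀ n : ℕ, 2 ≤ n → ∀ [NeZero n], ∀ b ∈ (univ : Finset (Fin 4 → Fin n)).image resSite, ∀ r : ℕ, n ≤ r →
      ∑ v ∈ annulus 4 r (r + 1), |gfrz n a b (v + unitVec ν + unitVec μ) - gfrz n a b (v + unitVec ν) - gfrz n a b (v + unitVec μ) + gfrz n a b v| ≤
        A₂ * Real.exp (-(δ₂ / n) * ((r : ℝ) + 1)) / ((r : ℝ) + 1))
    -- bridge B1
    (hB1 : ∀ m : ℕ, 1 ≤ m → |(∑ j ∈ range m, B12Beta.secondMoment (TbalOf Lc Js j) μ ν) - c (Lc ^ m)| ≤ U₁)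
    -- slot (K) with the loop-weight ratio and the PINNED normalisation
    (hK : ∀ n : ℕ, 2 ≤ n → Odd n → ∀ [NeZero n], c n =
      ωgl n * B12Beta.secondMoment (TOfRed n a (SbfBal n a (cE n) (cVH n) (cΛ n) (cR n) (cK n) (cQ n))
        (tableRed n (Wbf (cE₂ n) (cJ4 n) (cΛ₂ n) (cR₂ n) (cQ₂ n) (WE n) (WJ n) (WΛ n) (WR n) (WQ n)))) μ ν
      + ωgh n * B12Beta.secondMoment (PghQ n a (x₀ n) (cK n) (cQ n)) μ ν + ∑ u, Ru u n)
    (s : ℕ → ℝ) (hωs : ∀ n : ℕ, 2 ≤ n → ωgh n * (s n * cK n) ^ 2 = -2 * (ωgl n * cE n ^ 2))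
    (hlam : ∀ n : ℕ, 2 ≤ n → ωgl n * cE n ^ 2 = 2 * N ^ 2 * (n : ℝ) ^ 8)
    -- slot-table sockets
    (hδW : ∀ n, 0 < δW n)
    (hE : ∀ n κ u l u', BiLoc (WE n κ u l u') u u' (CE n) (δW n)) (hJ : ∀ n κ u l u', BiLoc (WJ n κ u l u') u u' (CJ n) (δW n))
    (hΛ : ∀ n κ u l u', BiLoc (WΛ n κ u l u') u u' (CΛ n) (δW n)) (hR : ∀ n κ u l u', BiLoc (WR n κ u l u') u u' (CRt n) (δW n))
    (hQ : ∀ n κ u l u', BiLoc (WQ n κ u l u') u u' (CQ n) (δW n))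
    (hEc : ∀ (n : ℕ) (κ : Fin 4) (u : Site 4) (l : Fin 4) (u' t : Site 4),
      WE n κ (u + (n : ℤ) • t) l (u' + (n : ℤ) • t) = shiftK (-((n : ℤ) • t)) (WE n κ u l u'))
    (hJc : ∀ (n : ℕ) (κ : Fin 4) (u : Site 4) (l : Fin 4) (u' t : Site 4),
      WJ n κ (u + (n : ℤ) • t) l (u' + (n : ℤ) • t) = shiftK (-((n : ℤ) • t)) (WJ n κ u l u'))
    (hΛc : ∀ (n : ℕ) (κ : Fin 4) (u : Site 4) (l : Fin 4) (u' t : Site 4),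
      WΛ n κ (u + (n : ℤ) • t) l (u' + (n : ℤ) • t) = shiftK (-((n : ℤ) • t)) (WΛ n κ u l u'))
    (hRc : ∀ (n : ℕ) (κ : Fin 4) (u : Site 4) (l : Fin 4) (u' t : Site 4),
      WR n κ (u + (n : ℤ) • t) l (u' + (n : ℤ) • t) = shiftK (-((n : ℤ) • t)) (WR n κ u l u'))
    (hQc : ∀ (n : ℕ) (κ : Fin 4) (u : Site 4) (l : Fin 4) (u' t : Site 4),
      WQ n κ (u + (n : ℤ) • t) l (u' + (n : ℤ) • t) = shiftK (-((n : ℤ) • t)) (WQ n κ u l u'))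
    (hEs : ∀ n κ u l u', WE n κ u l u' = WE n l u' κ u) (hJs : ∀ n κ u l u', WJ n κ u l u' = WJ n l u' κ u)
    (hΛs : ∀ n κ u l u', WΛ n κ u l u' = WΛ n l u' κ u) (hRs : ∀ n κ u l u', WR n κ u l u' = WR n l u' κ u)
    (hQs : ∀ n κ u l u', WQ n κ u l u' = WQ n l u' κ u)
    -- first-bond divergence-freeness of the gluon fine Hessian kernel; the ghost Ward rows
    (hdiv : ∀ n : ℕ, 2 ≤ n → ∀ [NeZero n], ∀ (l' : Fin 4) (u' u : Site 4), ∑ κ' : Fin 4,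
      (fineHess n a (SbfBal n a (cE n) (cVH n) (cΛ n) (cR n) (cK n) (cQ n))
          (Wbf (cE₂ n) (cJ4 n) (cΛ₂ n) (cR₂ n) (cQ₂ n) (WE n) (WJ n) (WΛ n) (WR n) (WQ n)) κ' l' (u - Pi.single κ' 1) u'
        - fineHess n a (SbfBal n a (cE n) (cVH n) (cΛ n) (cR n) (cK n) (cQ n))
          (Wbf (cE₂ n) (cJ4 n) (cΛ₂ n) (cR₂ n) (cQ₂ n) (WE n) (WJ n) (WΛ n) (WR n) (WQ n)) κ' l' u u') = 0)
    (hrowgh : ∀ n : ℕ, 2 ≤ n → ∀ [NeZero n], ∀ (κ' l' : Fin 4) (b : Site 4), HasSum (fineHessGhQ n a (x₀ n) (cK n) (cQ n) κ' l' b) 0)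
    -- (REST-GROUPS): the rest words labelled by `grp`, the corner exactly the fibre of `g₀`; ONE n-UNIFORM bound per group `g ≠ g₀`; (U)
    (hcorner : ∀ τ : RestIdx, grp τ = g₀ ↔ τ = cornerIdx)
    (hGrp : ∀ n : ℕ, 2 ≤ n → ∀ [NeZero n], ∀ g : G, g ≠ g₀ →
      |∑ b ∈ (univ : Finset (Fin 4 → Fin n)).image resSite, ((n : ℝ) ^ 4)⁻¹ *
        fullSum (fun w : Pt => ∑ τ ∈ (univ : Finset RestIdx).filter (fun τ => grp τ = g),
          restKS n a (gfrz n a b) (fun v => s n * gfrz n a b v) (cE n) (cΛ n) (cR n) (cK n) (cQ n) (cE₂ n) (cJ4 n) (cΛ₂ n) (cR₂ n) (cQ₂ n) (x₀ n)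
            (WE n) (WJ n) (WΛ n) (WR n) (WQ n) (ωgl n) (ωgh n) ((n : ℝ) ^ 8) N μ ν b τ w)| ≤ CG g)
    (hU : ∀ n : ℕ, 2 ≤ n → ∀ u, |Ru u n| ≤ CU u) :
    D1Drift Lc Js N μ ν :=
  d1Drift_BFx_total_shell_of_prop12S Js hμν hN hL hodd ha c hD₂ hA₂ hδ₂ h12 h126 h2s d2s hB1 hK s hωs hlam hδW hE hJ hΛ hR hQ hEc hJc hΛc hRc hQc
    hEs hJs hΛs hRs hQs hdiv hrowgh
    (hRestTot_of_hGroupsS ha hμν (hGa_of_prop12 ha h12 h126) hδW hE hJ hΛ hR hQ s hcorner hGrp) hU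

end Summit.QuantumFields.BalabanUV.Beta.D1BFx.RoadEndBFxTotalShellGroupsS

end
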